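import Literature.Barriers.QuantumAdvantage.UncorrectedNoiseIQP
import Mathlib.Analysis.SpecialFunctions.Trigonometric.Basic
import HarnessLib

/-!
# Parity correlators of the `CZ` + `Z`-rotation circuits of arXiv:2509.09033 (DEQ-E25, Lemma E25-2)

HONEST FRAMING: instance-level adjudication of specific advantage claims; no claim about BQP vs
BPP or the summit.

Source: arXiv:2509.09033v1, Definition 16 / Algorithm 1 / eq. (S.4.13).  The state
`(∏_{ab ∈ E(G)} CZ_{ab}) (∏_a e^{-i θ_a Z_a}) |+⟩^{⊗n}` is measured in the `X` basis.  Since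
`|+⟩^n = H^{⊗n}|0^n⟩` and an `X` measurement is `H^{⊗n}` followed by a computational one, the outcome
`y` has amplitude `⟨y| H^{⊗n} D H^{⊗n} |0^n⟩`, `D = CZ_G · RZ(θ)` diagonal with
`⟨z|D|z⟩ = ∏_a e^{-i θ_a (-1)^{z_a}} · (-1)^{#{ab ∈ E(G) : z_a = z_b = 1}}`.
Main theorem `correlator_eq_prod` (= Lemma E25-2 of the unit note `pub-qadeq-deq-2/DEQ-E25.md`):
  `E_y[(-1)^{Σ_{a∈S} y_a}] = (-1)^{e_G(S)} ∏_{a∉S} [m_a(S) even] ∏_{a∈S, m_a even} cos 2θ_a ∏_{a∈S, m_a odd} i sin 2θ_a`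
with `m_a(S) = #{b ∈ S : a ~ b}`, `e_G(S)` = number of edges inside `S`.  Corollaries: the marginals
`Pr[y_a = 1] = sin² θ_a` for `a` isolated in `G` (the population identity behind the estimator
`θ̂_a = arcsin √p̂_a`, (S.4.13)) and `Pr[y_a = 1] = 1/2` as soon as `a` has a neighbour.  A general
input `|x⟩` of Definition 16 reduces to the induced subgraph `G[{a : x_a = 0}]` (DEQ-E25, Lemma
E25-1; not formalised here).  Method: the Hadamard-sandwich / autocorrelation identities of
`Literature.Barriers.QuantumAdvantage.UncorrectedNoiseIQP` (`p̂(S) = 2^{-n} Σ_z \bar f(z) f(z ⊕ 1_S)`)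
for the phase function `f(z) = ⟨z|D|z⟩`, then an exact factorisation of `\bar f(z) f(z ⊕ 1_S)` over
the wires.  No `sorry`, standard axioms.  Intended tree location (to be filed by a permitted role,
not by a planner seat): `lean/Summits/QuantumAdvantage/Dequantization/GraphStateRotationCorrelators.lean`.
-/

noncomputable section

namespace Summit.QuantumAdvantage.Dequantization.GraphStateRotationCorrelators

open Finset Matrix
open scoped ComplexConjugate
open Literature.Probability.RandomGraphs.LowDegree (sgn walsh sgn_true sgn_false)
open Literature.Computability.Complexity.LowDegree (sum_walsh_mul_walsh_index)
open Literature.Computability.Cryptography (QReg hGateAll)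
open Literature.Barriers.QuantumAdvantage (supp bxor indic symmDiff_supp_eq_iff
  walsh_mul_walsh_eq_symmDiff hGateAll_apply_eq sqrt_two_inv_pow_mul_self walsh_supp_comm)

variable {n : ℕ} (G : SimpleGraph (Fin n)) [DecidableRel G.Adj] (θ : Fin n → ℝ)

/-- `e^{it}` for real `t`. -/
def expI (t : ℝ) : ℂ := Complex.exp ((t : ℂ) * Complex.I)
/-- `e^{i·0} = 1`. -/
@[simp] theorem expI_zero : expI 0 = 1 := by simp [expI]
/-- `|e^{it}| = 1`. -/
theorem norm_expI (t : ℝ) : ‖expI t‖ = 1 := Complex.norm_exp_ofReal_mul_I t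
/-- `e^{i(s+t)} = e^{is} e^{it}`. -/
theorem expI_add (s t : ℝ) : expI (s + t) = expI s * expI t := by
  rw [expI, expI, expI, ← Complex.exp_add]; push_cast; ring_nf
/-- `conj e^{it} = e^{-it}`. -/
theorem conj_expI (t : ℝ) : conj (expI t) = expI (-t) := by
  rw [expI, expI, ← Complex.exp_conj, map_mul, Complex.conj_ofReal, Complex.conj_I]; push_cast; ring_nf

/-- `e^{it} + e^{-it} = 2 cos t`. -/
theorem expI_add_expI_neg (t : ℝ) : expI t + expI (-t) = 2 * (Real.cos t : ℂ) := by
  rw [Complex.ofReal_cos, Complex.two_cos, expI, expI]; push_cast; ring_nf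

/-- `e^{it} - e^{-it} = 2 i sin t`. -/
theorem expI_sub_expI_neg (t : ℝ) : expI t - expI (-t) = 2 * (Complex.I * (Real.sin t : ℂ)) := by
  rw [Complex.ofReal_sin, expI, expI]; push_cast
  linear_combination (-Complex.I) * Complex.two_sin (t : ℂ)
    + (Complex.exp ((t : ℂ) * Complex.I) - Complex.exp (-(t : ℂ) * Complex.I)) * Complex.I_mul_I

/-- Phase of the rotation layer `∏_a e^{-i θ_a Z_a}` on `|z⟩`: `∏_a e^{-i θ_a (-1)^{z_a}}`
(`Z|b⟩ = (-1)^b |b⟩`, `sgn b = (-1)^b`). -/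
def rzPhase (z : QReg n) : ℂ := ∏ a, expI (-(θ a * sgn (z a)))

/-- Phase of the entangling layer `∏_{ab ∈ E(G)} CZ_{ab}` on `|z⟩`: `(-1)^{#{a<b : a ~ b, z_a = z_b = 1}}`. -/
def czSign (z : QReg n) : ℂ :=
  ∏ a, ∏ b, if a < b ∧ G.Adj a b ∧ z a = true ∧ z b = true then -1 else 1

/-- The diagonal entry `⟨z| CZ_G RZ(θ) |z⟩`. -/
def phase (z : QReg n) : ℂ := rzPhase θ z * czSign G z

/-- The output amplitude `⟨y| H^{⊗n} D H^{⊗n} |0^n⟩`. -/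
def amplitude (y : QReg n) : ℂ :=
  (hGateAll n * Matrix.diagonal (phase G θ) * hGateAll n) y (fun _ => false)

/-- The output probability of the bit string `y`. -/
def prob (y : QReg n) : ℝ := ‖amplitude G θ y‖ ^ 2

/-- The parity correlator `E_y[(-1)^{Σ_{a ∈ S} y_a}] = Σ_y p(y) χ_S(y)`. -/
def correlator (S : Finset (Fin n)) : ℝ := ∑ y, prob G θ y * walsh S y

/-- `m_a(S) = #{b ∈ S : a ~ b}`, the number of neighbours of `a` inside `S`. -/
def nbrIn (S : Finset (Fin n)) (a : Fin n) : ℕ := (univ.filter fun b => G.Adj a b ∧ b ∈ S).card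

/-- `e_G(S)`, the number of edges of `G` with both endpoints in `S` (as ordered pairs `a < b`). -/
def edgesIn (S : Finset (Fin n)) : ℕ :=
  (univ.filter fun p : Fin n × Fin n => p.1 < p.2 ∧ G.Adj p.1 p.2 ∧ p.1 ∈ S ∧ p.2 ∈ S).card

/-- The per-wire factor of the closed form. -/
def wire (S : Finset (Fin n)) (a : Fin n) : ℂ :=
  if a ∈ S then (if Even (nbrIn G S a) then (Real.cos (2 * θ a) : ℂ) else Complex.I * (Real.sin (2 * θ a) : ℂ))
  else (if Even (nbrIn G S a) then 1 else 0)
/-- The rotation-layer phase `∏_a e^{-i θ_a (-1)^{z_a}}` has modulus `1`. -/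
theorem norm_rzPhase (z : QReg n) : ‖rzPhase θ z‖ = 1 := by
  rw [rzPhase, norm_prod]; exact Finset.prod_eq_one fun a _ => norm_expI _
/-- The `CZ`-layer sign `c(z) ∈ {±1}` has modulus `1`. -/
theorem norm_czSign (z : QReg n) : ‖czSign G z‖ = 1 := by
  rw [czSign, norm_prod]
  exact Finset.prod_eq_one fun a _ => by
    rw [norm_prod]; exact Finset.prod_eq_one fun b _ => by split_ifs <;> simp
/-- The phase function `f(z) = ⟨z| CZ_G RZ(θ) |z⟩` has modulus `1`. -/
theorem norm_phase (z : QReg n) : ‖phase G θ z‖ = 1 := by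
  rw [phase, norm_mul, norm_rzPhase, norm_czSign, mul_one]
/-- The `CZ`-layer sign is real: `conj c(z) = c(z)`. -/
theorem conj_czSign (z : QReg n) : conj (czSign G z) = czSign G z := by
  rw [czSign, map_prod]
  exact Finset.prod_congr rfl fun a _ => by
    rw [map_prod]; exact Finset.prod_congr rfl fun b _ => by split_ifs <;> simp
/-- `χ_S(0^n) = 1`. -/
theorem walsh_allFalse (S : Finset (Fin n)) : walsh S (fun _ : Fin n => false) = 1 :=
  Finset.prod_eq_one fun _ _ => sgn_false

/-- `⟨y|H D H|0⟩ = 2^{-n} Σ_z χ_{supp y}(z) f(z)`. -/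
theorem amplitude_eq (y : QReg n) :
    amplitude G θ y = ((2 : ℂ) ^ n)⁻¹ * ∑ z, ((walsh (supp y) z : ℝ) : ℂ) * phase G θ z := by
  unfold amplitude
  rw [Matrix.mul_apply]
  simp_rw [Matrix.mul_diagonal, hGateAll_apply_eq, walsh_allFalse, Complex.ofReal_one, mul_one]
  rw [← sqrt_two_inv_pow_mul_self, Finset.mul_sum]
  exact Finset.sum_congr rfl fun z _ => by ring

/-- `p(y)` as a double character sum. -/
theorem prob_eq_sum (y : QReg n) :
    ((prob G θ y : ℝ) : ℂ) = ((2 : ℂ) ^ n)⁻¹ * ((2 : ℂ) ^ n)⁻¹ *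
      ∑ z, ∑ z', ((walsh (symmDiff (supp z) (supp z')) y : ℝ) : ℂ) *
        (phase G θ z * conj (phase G θ z')) := by
  rw [prob, ← Complex.normSq_eq_norm_sq, ← Complex.mul_conj, amplitude_eq]
  rw [map_mul, map_inv₀, map_pow, Complex.conj_ofNat, map_sum,
    show ∀ (c A B : ℂ), c * A * (c * B) = c * c * (A * B) from fun c A B => by ring, Finset.sum_mul_sum]
  congr 1
  refine Finset.sum_congr rfl fun z _ => Finset.sum_congr rfl fun z' _ => ?_
  rw [map_mul, Complex.conj_ofReal, ← walsh_mul_walsh_eq_symmDiff, walsh_supp_comm z y,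
    walsh_supp_comm z' y]
  push_cast; ring

/-- **Parity correlators are autocorrelations of the phase function**:
`E[χ_S] = 2^{-n} Σ_z \bar f(z) f(z ⊕ 1_S)`. -/
theorem correlator_eq_autocorrelation (S : Finset (Fin n)) :
    ((correlator G θ S : ℝ) : ℂ) =
      ((2 : ℂ) ^ n)⁻¹ * ∑ z', conj (phase G θ z') * phase G θ (bxor z' (indic S)) := by
  have h2 : (2 : ℂ) ^ n ≠ 0 := pow_ne_zero _ two_ne_zero
  unfold correlator
  rw [Complex.ofReal_sum]
  simp_rw [Complex.ofReal_mul, prob_eq_sum]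
  have step : ∀ y : QReg n, ((2 : ℂ) ^ n)⁻¹ * ((2 : ℂ) ^ n)⁻¹ *
      (∑ z, ∑ z', ((walsh (symmDiff (supp z) (supp z')) y : ℝ) : ℂ) *
        (phase G θ z * conj (phase G θ z'))) * ((walsh S y : ℝ) : ℂ) =
      ((2 : ℂ) ^ n)⁻¹ * ((2 : ℂ) ^ n)⁻¹ *
      ∑ z, ∑ z', ((walsh (symmDiff (supp z) (supp z')) y * walsh S y : ℝ) : ℂ) *
        (phase G θ z * conj (phase G θ z')) := by
    intro y
    rw [mul_assoc, Finset.sum_mul]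
    congr 1
    refine Finset.sum_congr rfl fun z _ => ?_
    rw [Finset.sum_mul]
    refine Finset.sum_congr rfl fun z' _ => ?_
    push_cast; ring
  simp_rw [step]
  rw [← Finset.mul_sum, Finset.sum_comm]
  simp_rw [Finset.sum_comm (s := (univ : Finset (QReg n))) (t := (univ : Finset (QReg n)))
    (f := fun y z' => ((walsh (symmDiff (supp _) (supp z')) y * walsh S y : ℝ) : ℂ) * _)]
  have hw : ∀ z z' : QReg n, ∑ y, ((walsh (symmDiff (supp z) (supp z')) y * walsh S y : ℝ) : ℂ) *
      (phase G θ z * conj (phase G θ z')) =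
      if z = bxor z' (indic S) then (2 : ℂ) ^ n * (phase G θ z * conj (phase G θ z')) else 0 := by
    intro z z'
    rw [← Finset.sum_mul, ← Complex.ofReal_sum, sum_walsh_mul_walsh_index]
    by_cases h : z = bxor z' (indic S)
    · rw [if_pos ((symmDiff_supp_eq_iff z z' S).mpr h), if_pos h]; push_cast; ring
    · rw [if_neg (fun h' => h ((symmDiff_supp_eq_iff z z' S).mp h')), if_neg h]; push_cast; ring
  simp_rw [hw]
  rw [Finset.sum_comm]
  simp_rw [Finset.sum_ite_eq' univ, if_pos (Finset.mem_univ _)]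
  rw [← Finset.mul_sum]
  field_simp
  exact Finset.sum_congr rfl fun z' _ => by ring

/-- **Normalisation** `Σ_y p(y) = 1` (the case `S = ∅` of the autocorrelation identity). -/
theorem sum_prob : ∑ y, prob G θ y = 1 := by
  have h2 : (2 : ℂ) ^ n ≠ 0 := pow_ne_zero _ two_ne_zero
  have h := correlator_eq_autocorrelation G θ ∅
  simp_rw [show ∀ z : QReg n, bxor z (indic (∅ : Finset (Fin n))) = z from fun z => by
      funext i; simp [bxor, indic], Complex.conj_mul', norm_phase] at h
  simp only [correlator, Literature.Probability.RandomGraphs.LowDegree.walsh_empty, mul_one,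
    Complex.ofReal_one, one_pow, Finset.sum_const, Finset.card_univ, Fintype.card_fun, Fintype.card_bool,
    Fintype.card_fin, nsmul_eq_mul, Nat.cast_pow, Nat.cast_ofNat, inv_mul_cancel₀ h2] at h
  exact_mod_cast h

/-- Rotation layer: `\bar r(z) r(z ⊕ 1_S) = ∏_{a ∈ S} e^{2 i θ_a (-1)^{z_a}}`. -/
theorem conj_rzPhase_mul_shift (z : QReg n) (S : Finset (Fin n)) :
    conj (rzPhase θ z) * rzPhase θ (bxor z (indic S)) =
      ∏ a, (if a ∈ S then expI (2 * θ a * sgn (z a)) else 1) := by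
  rw [rzPhase, rzPhase, map_prod, ← Finset.prod_mul_distrib]
  refine Finset.prod_congr rfl fun a _ => ?_
  rw [conj_expI, ← expI_add]
  by_cases ha : a ∈ S
  · rw [if_pos ha, show bxor z (indic S) a = !z a by simp [bxor, indic, ha]]
    congr 1
    cases z a <;> simp only [Bool.not_true, Bool.not_false, sgn_true, sgn_false] <;> ring
  · rw [if_neg ha, show bxor z (indic S) a = z a by simp [bxor, indic, ha], neg_neg, add_neg_cancel,
      expI_zero]

/-- Entangling layer, one ordered pair: `c_{ab}(z) c_{ab}(z ⊕ s) = c_{ab}(s) · (-1)^{z_a s_b} (-1)^{z_b s_a}`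
on an edge `a < b`. -/
theorem czPair_mul_shift (a b : Fin n) (z s : QReg n) :
    (if a < b ∧ G.Adj a b ∧ z a = true ∧ z b = true then (-1 : ℂ) else 1) *
      (if a < b ∧ G.Adj a b ∧ bxor z s a = true ∧ bxor z s b = true then (-1 : ℂ) else 1) =
    (if a < b ∧ G.Adj a b ∧ s a = true ∧ s b = true then (-1 : ℂ) else 1) *
      ((if a < b ∧ G.Adj a b ∧ s b = true then ((sgn (z a) : ℝ) : ℂ) else 1) *
       (if a < b ∧ G.Adj a b ∧ s a = true then ((sgn (z b) : ℝ) : ℂ) else 1)) := by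
  by_cases h : a < b ∧ G.Adj a b
  · obtain ⟨h1, h2⟩ := h
    simp only [h1, h2, true_and, bxor]
    cases z a <;> cases z b <;> cases s a <;> cases s b <;> norm_num
  · have h' : ∀ P : Prop, (a < b ∧ G.Adj a b ∧ P) ↔ False := fun P =>
      ⟨fun hP => h ⟨hP.1, hP.2.1⟩, False.elim⟩
    simp only [h', if_false, mul_one]

/-- Entangling layer: `c(z) c(z ⊕ s) = c(s) · ∏_{a<b, a~b} (-1)^{z_a s_b} · ∏_{a<b, a~b} (-1)^{z_b s_a}`. -/
theorem czSign_mul_shift (z s : QReg n) :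
    czSign G z * czSign G (bxor z s) =
      czSign G s * ((∏ a, ∏ b, if a < b ∧ G.Adj a b ∧ s b = true then ((sgn (z a) : ℝ) : ℂ) else 1) *
        (∏ a, ∏ b, if a < b ∧ G.Adj a b ∧ s a = true then ((sgn (z b) : ℝ) : ℂ) else 1)) := by
  simp only [czSign, ← Finset.prod_mul_distrib]
  exact Finset.prod_congr rfl fun a _ => Finset.prod_congr rfl fun b _ => czPair_mul_shift G a b z s

/-- Re-indexing the second product by the larger endpoint (`G.Adj` is symmetric). -/
theorem prod_pair_swap (z s : QReg n) :
    (∏ a, ∏ b, if a < b ∧ G.Adj a b ∧ s a = true then ((sgn (z b) : ℝ) : ℂ) else 1) =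
      ∏ a, ∏ b, if b < a ∧ G.Adj a b ∧ s b = true then ((sgn (z a) : ℝ) : ℂ) else 1 := by
  rw [Finset.prod_comm]
  refine Finset.prod_congr rfl fun a _ => Finset.prod_congr rfl fun b _ => ?_
  exact if_congr ⟨fun ⟨h1, h2, h3⟩ => ⟨h1, h2.symm, h3⟩, fun ⟨h1, h2, h3⟩ => ⟨h1, h2.symm, h3⟩⟩ rfl rfl

/-- Merging the `a < b` and `b < a` halves: every wire `a` collects `(-1)^{z_a}` once per neighbour
`b` with `s_b = 1` (`G` is loopless). -/
theorem prod_pair_merge (z s : QReg n) :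
    (∏ a, ∏ b, if a < b ∧ G.Adj a b ∧ s b = true then ((sgn (z a) : ℝ) : ℂ) else 1) *
      (∏ a, ∏ b, if b < a ∧ G.Adj a b ∧ s b = true then ((sgn (z a) : ℝ) : ℂ) else 1) =
    ∏ a, ((sgn (z a) : ℝ) : ℂ) ^ (univ.filter fun b => G.Adj a b ∧ s b = true).card := by
  rw [← Finset.prod_mul_distrib]
  refine Finset.prod_congr rfl fun a _ => ?_
  rw [← Finset.prod_mul_distrib]
  have hab : ∀ b, ((if a < b ∧ G.Adj a b ∧ s b = true then ((sgn (z a) : ℝ) : ℂ) else 1) *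
      (if b < a ∧ G.Adj a b ∧ s b = true then ((sgn (z a) : ℝ) : ℂ) else 1)) =
      if G.Adj a b ∧ s b = true then ((sgn (z a) : ℝ) : ℂ) else 1 := by
    intro b
    by_cases hP : G.Adj a b ∧ s b = true
    · rw [if_pos hP]
      rcases lt_trichotomy a b with h | rfl | h
      · rw [if_pos ⟨h, hP⟩, if_neg (fun h' => lt_asymm h h'.1), mul_one]
      · exact absurd hP.1 G.irrefl
      · rw [if_neg (fun h' => lt_asymm h h'.1), if_pos ⟨h, hP⟩, one_mul]
    · rw [if_neg hP, if_neg (fun h' => hP h'.2), if_neg (fun h' => hP h'.2), mul_one]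
  simp_rw [hab]
  rw [Finset.prod_ite, Finset.prod_const_one, mul_one, Finset.prod_const]
/-- `#{b : a ~ b, 1_S(b) = 1} = m_a(S)` (indicator form of `nbrIn`). -/
theorem card_filter_adj_indic (S : Finset (Fin n)) (a : Fin n) :
    (univ.filter fun b => G.Adj a b ∧ indic S b = true).card = nbrIn G S a :=
  congrArg Finset.card (Finset.filter_congr fun b _ => by simp [indic])

/-- `c(1_S) = (-1)^{e_G(S)}`. -/
theorem czSign_indic (S : Finset (Fin n)) : czSign G (indic S) = (-1) ^ edgesIn G S := by
  unfold czSign edgesIn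
  simp_rw [← Finset.prod_product', Finset.univ_product_univ]
  rw [Finset.prod_ite, Finset.prod_const_one, mul_one, Finset.prod_const]
  exact congrArg (fun k : ℕ => (-1 : ℂ) ^ k)
    (congrArg Finset.card (Finset.filter_congr fun p _ => by simp [indic]))

/-- **Wire factorisation of the autocorrelation summand**:
`\bar f(z) f(z ⊕ 1_S) = c(1_S) · ∏_a (-1)^{z_a m_a(S)} · ∏_{a ∈ S} e^{2iθ_a(-1)^{z_a}}`. -/
theorem autocorr_summand (z : QReg n) (S : Finset (Fin n)) :
    conj (phase G θ z) * phase G θ (bxor z (indic S)) =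
      czSign G (indic S) * ∏ a, (((sgn (z a) : ℝ) : ℂ) ^ nbrIn G S a *
        (if a ∈ S then expI (2 * θ a * sgn (z a)) else 1)) := by
  rw [phase, phase, map_mul, conj_czSign,
    show ∀ A B C D : ℂ, A * B * (C * D) = (A * C) * (B * D) from fun _ _ _ _ => by ring,
    conj_rzPhase_mul_shift, czSign_mul_shift, prod_pair_swap, prod_pair_merge, Finset.prod_mul_distrib]
  simp_rw [card_filter_adj_indic]
  ring

/-- **Summing one wire over its bit**: `Σ_{b} (-1)^{b m} [a ∈ S ? e^{2iθ(-1)^b} : 1] = 2 · wire`. -/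
theorem wire_sum (S : Finset (Fin n)) (a : Fin n) :
    ∑ b : Bool, (((sgn b : ℝ) : ℂ) ^ nbrIn G S a * (if a ∈ S then expI (2 * θ a * sgn b) else 1)) =
      2 * wire G θ S a := by
  rw [Fintype.sum_bool, wire]
  simp only [sgn_true, sgn_false, Complex.ofReal_neg, Complex.ofReal_one, one_pow, one_mul, mul_neg,
    mul_one]
  by_cases ha : a ∈ S
  · simp only [ha, if_true]
    rcases Nat.even_or_odd (nbrIn G S a) with he | ho
    · rw [if_pos he, he.neg_one_pow]
      linear_combination expI_add_expI_neg (2 * θ a)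
    · rw [if_neg (Nat.not_even_iff_odd.mpr ho), ho.neg_one_pow]
      linear_combination expI_sub_expI_neg (2 * θ a)
  · simp only [ha, if_false]
    rcases Nat.even_or_odd (nbrIn G S a) with he | ho
    · rw [if_pos he, he.neg_one_pow]; ring
    · rw [if_neg (Nat.not_even_iff_odd.mpr ho), ho.neg_one_pow]; ring

/-- **Lemma E25-2 (closed form of every parity correlator).**
`E_y[(-1)^{Σ_{a∈S} y_a}] = (-1)^{e_G(S)} ∏_a wire_a`, with `wire_a = cos 2θ_a` (`a ∈ S`, `m_a(S)` even),
`i sin 2θ_a` (`a ∈ S`, `m_a(S)` odd), `1` (`a ∉ S`, `m_a(S)` even), `0` (`a ∉ S`, `m_a(S)` odd).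
[DEQ-E25 §2, Lemma E25-2; derived here from arXiv:2509.09033v1 Def. 16] -/
theorem correlator_eq_prod (S : Finset (Fin n)) :
    ((correlator G θ S : ℝ) : ℂ) = (-1) ^ edgesIn G S * ∏ a, wire G θ S a := by
  have h2 : (2 : ℂ) ^ n ≠ 0 := pow_ne_zero _ two_ne_zero
  rw [correlator_eq_autocorrelation]
  simp_rw [autocorr_summand]
  have hfac : ∑ z : QReg n, ∏ a, (((sgn (z a) : ℝ) : ℂ) ^ nbrIn G S a *
        (if a ∈ S then expI (2 * θ a * sgn (z a)) else 1)) =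
      ∏ a, ∑ b : Bool, (((sgn b : ℝ) : ℂ) ^ nbrIn G S a *
        (if a ∈ S then expI (2 * θ a * sgn b) else 1)) :=
    (Fintype.prod_sum (fun a (b : Bool) => ((sgn b : ℝ) : ℂ) ^ nbrIn G S a *
        (if a ∈ S then expI (2 * θ a * sgn b) else 1))).symm
  rw [← Finset.mul_sum, hfac]
  simp_rw [wire_sum]
  rw [Finset.prod_mul_distrib, Finset.prod_const, Finset.card_univ, Fintype.card_fin, czSign_indic,
    show ∀ A B : ℂ, ((2 : ℂ) ^ n)⁻¹ * (A * ((2 : ℂ) ^ n * B)) = (((2 : ℂ) ^ n)⁻¹ * (2 : ℂ) ^ n) * (A * B)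
      from fun A B => by ring, inv_mul_cancel₀ h2, one_mul]

/-- If some `a ∉ S` has an odd number of neighbours in `S`, the `S`-parity of the output is unbiased. -/
theorem correlator_eq_zero_of_odd {S : Finset (Fin n)} {a : Fin n} (ha : a ∉ S)
    (hodd : Odd (nbrIn G S a)) : correlator G θ S = 0 := by
  have h := correlator_eq_prod G θ S
  rw [Finset.prod_eq_zero (Finset.mem_univ a)
      (by rw [wire, if_neg ha, if_neg (Nat.not_even_iff_odd.mpr hodd)]), mul_zero] at h
  exact_mod_cast h
/-- `m_b({a}) = [b ~ a]`. -/
theorem nbrIn_singleton (a b : Fin n) : nbrIn G {a} b = if G.Adj b a then 1 else 0 := by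
  unfold nbrIn
  by_cases h : G.Adj b a
  · rw [if_pos h, Finset.card_eq_one]
    refine ⟨a, ?_⟩
    ext c
    simp only [Finset.mem_filter, Finset.mem_univ, true_and, Finset.mem_singleton]
    exact ⟨fun hc => hc.2, fun hc => ⟨hc ▸ h, hc⟩⟩
  · rw [if_neg h, Finset.card_eq_zero, Finset.filter_eq_empty_iff]
    rintro c - ⟨hbc, hc⟩
    exact h ((Finset.mem_singleton.mp hc) ▸ hbc)
/-- `e_G({a}) = 0`: a singleton spans no edge. -/
theorem edgesIn_singleton (a : Fin n) : edgesIn G {a} = 0 := by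
  rw [edgesIn, Finset.card_eq_zero, Finset.filter_eq_empty_iff]
  rintro p - ⟨hlt, -, h1, h2⟩
  rw [Finset.mem_singleton] at h1 h2
  exact lt_irrefl _ (h1 ▸ h2 ▸ hlt)

/-- An isolated wire: `E[(-1)^{y_a}] = cos 2θ_a`. -/
theorem correlator_singleton_of_isolated (a : Fin n) (hiso : ∀ b, ¬ G.Adj a b) :
    correlator G θ {a} = Real.cos (2 * θ a) := by
  have hw : ∀ b, b ≠ a → wire G θ {a} b = 1 := fun b hb => by
    rw [wire, if_neg (by rwa [Finset.mem_singleton]), nbrIn_singleton,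
      if_neg (show ¬ G.Adj b a from fun h => hiso b h.symm), if_pos Even.zero]
  have hwa : wire G θ {a} a = Real.cos (2 * θ a) := by
    rw [wire, if_pos (Finset.mem_singleton_self a), nbrIn_singleton, if_neg G.irrefl,
      if_pos Even.zero]
  have h := correlator_eq_prod G θ {a}
  rw [edgesIn_singleton, pow_zero, one_mul,
    Finset.prod_eq_single a (fun b _ hb => hw b hb) (fun h => absurd (Finset.mem_univ a) h), hwa] at h
  exact_mod_cast h

/-- A wire with a neighbour: `E[(-1)^{y_a}] = 0`. -/
theorem correlator_singleton_eq_zero {a b : Fin n} (hab : G.Adj a b) : correlator G θ {a} = 0 :=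
  correlator_eq_zero_of_odd G θ (S := {a}) (a := b)
    (by rw [Finset.mem_singleton]; rintro rfl; exact G.irrefl hab)
    (by rw [nbrIn_singleton, if_pos hab.symm]; exact odd_one)

/-- `Pr[y_a = 1]`. -/
def probBitOne (a : Fin n) : ℝ := ∑ y ∈ univ.filter (fun y : QReg n => y a = true), prob G θ y

/-- `Pr[y_a = 1] = (1 - E[(-1)^{y_a}]) / 2`. -/
theorem probBitOne_eq (a : Fin n) : probBitOne G θ a = (1 - correlator G θ {a}) / 2 := by
  have h : ∀ y : QReg n, prob G θ y * walsh {a} y =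
      prob G θ y - 2 * (if y a = true then prob G θ y else 0) := fun y => by
    rw [walsh, Finset.prod_singleton]
    cases y a
    · simp
    · rw [if_pos rfl, sgn_true]; ring
  rw [probBitOne, Finset.sum_filter, correlator, Finset.sum_congr rfl fun y _ => h y,
    Finset.sum_sub_distrib, sum_prob, ← Finset.mul_sum]
  ring

/-- **(S.4.13)** An isolated wire reveals its angle: `Pr[y_a = 1] = sin² θ_a`. -/
theorem probBitOne_of_isolated (a : Fin n) (hiso : ∀ b, ¬ G.Adj a b) :
    probBitOne G θ a = Real.sin (θ a) ^ 2 := by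
  rw [probBitOne_eq, correlator_singleton_of_isolated G θ a hiso, Real.cos_two_mul, Real.sin_sq]
  ring

/-- A wire with a neighbour is a fair coin: `Pr[y_a = 1] = 1/2` (no information on `θ`). -/
theorem probBitOne_of_adj {a b : Fin n} (hab : G.Adj a b) : probBitOne G θ a = 1 / 2 := by
  rw [probBitOne_eq, correlator_singleton_eq_zero G θ hab]; norm_num

end Summit.QuantumAdvantage.Dequantization.GraphStateRotationCorrelators

end
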